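import Summits.CriticalPhenomena.PercolationContinuityZ3.Theorems.PercNearOneGluingNoHeavyLowerTailThreeSumSums
import Summits.CriticalPhenomena.PercolationContinuityZ3.Theorems.PercNearOneGluingNoHeavyLowerTailWheelCertificateFull
import HarnessLib

/-!
# `NoHeavyLowerTail` (stmt-CriticalPhenomena-4575) — THE 3-SUM THEOREM FOR R1 AT THE MEASURE LEVEL:
# R1 ∧ LB ∧ LG on the pieces ⟹ R1 on the graph glued along `{a,b,c}`, for every `φ_{𝐩,q}`, every `q > 0`

Support file (prover prim-gen-kcluster gen 71; `--supports stmt-CriticalPhenomena-4575`).  No definitions, no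
named facts, no sorries.  Completes blueprint KCLUSTER-gen69.md §9 (N3b): the kernel MEASURE-LEVEL form of the
3-sum theorem whose algebraic core is `WheelR1.wheel_certificate` (p375044; paper THEOREM-3SUM.md).

SE({a, b, c} : Set V)ING.  Finite vertex type `V`; distinct terminals `a` (apex), `b, c`; two edge supports
`DA DB : Finset (Sym2 V)` MEETING ONLY IN `{a,b,c}` (every vertex on a pair of `DA` and on a pair of `DB` is a
terminal); parameters `w : Sym2 V → [0,1]` vanishing off `DA ∪ DB` (the glued weighted graph), `wA = w·1_{DA}`,
`wB = w·1_{DAᶜ}` (the pieces); `φ = rcMeasureW w q ∅`, `φ_A = rcMeasureW wA q ∅`, `φ_B = rcMeasureW wB q ∅`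
(free random-cluster measures, any `q > 0`).  Three-point cells of the instance `(a; b, c)` with support `D`
(clusters `Gladkov.cl`, support separation `RefinedRowR3.Sep` as in `SepDual` / `RCFolding`):
`T = {b, c ∈ C(a)}`, `U_b = {b ∈ C(a), c ∉ C(a)}`, `U_c`, `S_D = {b, c ∉ C(a), C(a) meets every b–c path of D}`,
`U_a = {b, c ∉ C(a), c ∈ C(b)}`, `N_D = {a, b, c pairwise apart, C(a) misses some b–c path of D}`.
Rows: **R1** `φ(T) φ(S) ≤ φ(U_b) φ(U_c)`; **LB** `φ(S) φ(U_a) ≤ φ(N) φ(U_b)`; **LG** `φ(S) φ(U_a) ≤ φ(N) φ(U_c)`.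

**THEOREM** (`ThreeSum.r1_of_threeSum`).  If `φ_A` satisfies R1, LB, LG (support `DA`) and `φ_B` satisfies
R1, LB, LG (support `DB`), then `φ` satisfies R1 (support `D = DA ∪ DB`, given by its membership predicate).

PROOF.  By parts 1–5 (`…ThreeSumCount/Glue/Cells/Pointwise/Sums`) the four masses of `φ`, times the constant
`q^{k^T(∅)}`, are bilinear forms in the `T`-wired cell masses of the pieces (the DICTIONARY); the piece rows
are, cell by cell, the same inequalities between wired masses (`k = k^T + blocks − 1` on each cell,
`piece_*`); and the resulting polynomial inequality is exactly `WheelR1.wheel_certificate` at `x = y = 0` with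
`d = 0`, `t = R(abc)`, `e + s = R(a|b|c)` (`piece_split`), `M = R(abc)+R(ab|c)+R(ac|b)+R(a|bc)+R(a|b|c)`
(`piece_total`).  Consequences (memo KCLUSTER-gen69 §6, for `q ≥ 1` where LB, LG ⟸ R4⁺ ⟸ R1,
`SepDual.r4plus_of_r1_rcMeasureW`): R1-RC on every graph all of whose `{a,b,c}`-bridges satisfy R1 — wheels,
`K_{3,n}`, graphs with series-parallel bridges; a minimal counterexample to R1-RC has `G − {a,b,c}` connected.
-/

noncomputable section

namespace Summit.CriticalPhenomena.PercolationContinuityZ3.Theorems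

namespace ThreeSum

open Finset SimpleGraph Literature.Probability.Percolation Literature.Probability.Percolation.Gladkov
open Literature.Probability.Percolation.BHK2006 (weight)
open Literature.Probability.Percolation.DecisionTree (ind ind_of_mem ind_of_not_mem ind_nonneg)
open Literature.Probability.LatticeModels RefinedRowR3 ThreePointLB MeasureTheory
open scoped Classical

variable {V : Type*} [Fintype V]

/-! ### The piece rows in wired masses -/

section Piece

variable {a b c : V} (hab : a ≠ b) (hac : a ≠ c) (hbc : b ≠ c) (u : Sym2 V → unitInterval) (q : ℝ)
include hab hac hbc

omit hab hac hbc in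
/-- A configuration inside `↑D` is, as a finite set, inside `D`. [folklore] -/
theorem toFinset_subset_of_subset_coe {D : Finset (Sym2 V)} {η : BondConfig V} (hη : η ⊆ ↑D) :
    η.toFinset ⊆ D := fun e he => by
  rw [mem_toFinset'] at he; exact hη he

/-- Cell `abc`: free mass = wired mass. [this work] -/
theorem piece_T :
    ∑ η : BondConfig V, rcWeightW u q ∅ η * ind {η : BondConfig V | b ∈ cl η.toFinset a ∧ c ∈ cl η.toFinset a} η = ∑ η : BondConfig V, rcWeightW u q ({a, b, c} : Set V) η * ind {η : BondConfig V | b ∈ cl η.toFinset a ∧ c ∈ cl η.toFinset a} η := by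
  refine Finset.sum_congr rfl fun η _ => ?_
  by_cases h : η ∈ {η : BondConfig V | b ∈ cl η.toFinset a ∧ c ∈ cl η.toFinset a}
  · unfold rcWeightW; rw [k_cell_T hab hac hbc η h.1 h.2]
  · rw [ind_of_not_mem h, mul_zero, mul_zero]

/-- Cell `ab|c`: free mass = `q ·` wired mass. [this work] -/
theorem piece_Ub :
    ∑ η : BondConfig V, rcWeightW u q ∅ η * ind {η : BondConfig V | b ∈ cl η.toFinset a ∧ c ∉ cl η.toFinset a} η = q * ∑ η : BondConfig V, rcWeightW u q ({a, b, c} : Set V) η * ind {η : BondConfig V | b ∈ cl η.toFinset a ∧ c ∉ cl η.toFinset a} η := by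
  rw [Finset.mul_sum]
  refine Finset.sum_congr rfl fun η _ => ?_
  by_cases h : η ∈ {η : BondConfig V | b ∈ cl η.toFinset a ∧ c ∉ cl η.toFinset a}
  · unfold rcWeightW; rw [k_cell_Ub hab hac hbc η h.1 h.2, pow_succ]; ring
  · rw [ind_of_not_mem h, mul_zero, mul_zero, mul_zero]

/-- Cell `ac|b`: free mass = `q ·` wired mass. [this work] -/
theorem piece_Uc :
    ∑ η : BondConfig V, rcWeightW u q ∅ η * ind {η : BondConfig V | b ∉ cl η.toFinset a ∧ c ∈ cl η.toFinset a} η = q * ∑ η : BondConfig V, rcWeightW u q ({a, b, c} : Set V) η * ind {η : BondConfig V | b ∉ cl η.toFinset a ∧ c ∈ cl η.toFinset a} η := by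
  rw [Finset.mul_sum]
  refine Finset.sum_congr rfl fun η _ => ?_
  by_cases h : η ∈ {η : BondConfig V | b ∉ cl η.toFinset a ∧ c ∈ cl η.toFinset a}
  · unfold rcWeightW; rw [k_cell_Uc hab hac hbc η h.1 h.2, pow_succ]; ring
  · rw [ind_of_not_mem h, mul_zero, mul_zero, mul_zero]

/-- Cell `a|bc`: free mass = `q ·` wired mass. [this work] -/
theorem piece_N :
    ∑ η : BondConfig V, rcWeightW u q ∅ η * ind {η : BondConfig V | b ∉ cl η.toFinset a ∧ c ∉ cl η.toFinset a ∧ c ∈ cl η.toFinset b} η = q * ∑ η : BondConfig V, rcWeightW u q ({a, b, c} : Set V) η * ind {η : BondConfig V | b ∉ cl η.toFinset a ∧ c ∉ cl η.toFinset a ∧ c ∈ cl η.toFinset b} η := by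
  rw [Finset.mul_sum]
  refine Finset.sum_congr rfl fun η _ => ?_
  by_cases h : η ∈ {η : BondConfig V | b ∉ cl η.toFinset a ∧ c ∉ cl η.toFinset a ∧ c ∈ cl η.toFinset b}
  · unfold rcWeightW; rw [k_cell_N hab hac hbc η h.1 h.2.2, pow_succ]; ring
  · rw [ind_of_not_mem h, mul_zero, mul_zero, mul_zero]

/-- Cell `N_D` (pairwise apart, not separated): free mass = `q² ·` wired mass. [this work] -/
theorem piece_E (D : Finset (Sym2 V)) :
    ∑ η : BondConfig V, rcWeightW u q ∅ η * ind {η : BondConfig V | b ∉ cl η.toFinset a ∧ c ∉ cl η.toFinset a ∧ c ∉ cl η.toFinset b ∧ ¬ Sep D (cl η.toFinset a) b c} η =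
      q ^ 2 * ∑ η : BondConfig V, rcWeightW u q ({a, b, c} : Set V) η * ind {η : BondConfig V | b ∉ cl η.toFinset a ∧ c ∉ cl η.toFinset a ∧ c ∉ cl η.toFinset b ∧ ¬ Sep D (cl η.toFinset a) b c} η := by
  rw [Finset.mul_sum]
  refine Finset.sum_congr rfl fun η _ => ?_
  by_cases h : η ∈ {η : BondConfig V | b ∉ cl η.toFinset a ∧ c ∉ cl η.toFinset a ∧ c ∉ cl η.toFinset b ∧ ¬ Sep D (cl η.toFinset a) b c}
  · unfold rcWeightW; rw [k_cell_apart hab hac hbc η h.1 h.2.1 h.2.2.1, pow_add]; ring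
  · rw [ind_of_not_mem h, mul_zero, mul_zero, mul_zero]

variable {D : Finset (Sym2 V)} (hu : ∀ e, e ∉ (↑D : Set (Sym2 V)) → (u e : ℝ) = 0)
include hu

/-- Separating cell `S_D`: free mass = `q² ·` wired mass (off the support the weight vanishes; on it,
separation forces `a, b, c` pairwise apart, `ThreeSum.not_sep_of_mem_cl`). [this work] -/
theorem piece_S :
    ∑ η : BondConfig V, rcWeightW u q ∅ η * ind {η : BondConfig V | b ∉ cl η.toFinset a ∧ c ∉ cl η.toFinset a ∧ Sep D (cl η.toFinset a) b c} η =
      q ^ 2 * ∑ η : BondConfig V, rcWeightW u q ({a, b, c} : Set V) η * ind {η : BondConfig V | b ∉ cl η.toFinset a ∧ c ∉ cl η.toFinset a ∧ Sep D (cl η.toFinset a) b c} η := by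
  rw [Finset.mul_sum]
  refine Finset.sum_congr rfl fun η _ => ?_
  by_cases hη : η ⊆ ↑D
  · by_cases h : η ∈ {η : BondConfig V | b ∉ cl η.toFinset a ∧ c ∉ cl η.toFinset a ∧ Sep D (cl η.toFinset a) b c}
    · have hcb : c ∉ cl η.toFinset b := fun h' =>
        not_sep_of_mem_cl (toFinset_subset_of_subset_coe hη) h.1 h' h.2.2
      unfold rcWeightW; rw [k_cell_apart hab hac hbc η h.1 h.2.1 hcb, pow_add]; ring
    · rw [ind_of_not_mem h, mul_zero, mul_zero, mul_zero]
  · unfold rcWeightW; rw [weight_eq_zero_of_not_subset u hu hη]; ring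

omit hab hac hbc in
/-- `R(a|b|c) = R(S_D) + R(N_D)` for the wired masses (on the support the pairwise-apart cell splits by
separation; separation already forces `c ∉ C(b)`). [this work] -/
theorem piece_split :
    ∑ η : BondConfig V, rcWeightW u q ({a, b, c} : Set V) η * ind {η : BondConfig V | b ∉ cl η.toFinset a ∧ c ∉ cl η.toFinset a ∧ c ∉ cl η.toFinset b} η =
      (∑ η : BondConfig V, rcWeightW u q ({a, b, c} : Set V) η * ind {η : BondConfig V | b ∉ cl η.toFinset a ∧ c ∉ cl η.toFinset a ∧ Sep D (cl η.toFinset a) b c} η) +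
        ∑ η : BondConfig V, rcWeightW u q ({a, b, c} : Set V) η * ind {η : BondConfig V | b ∉ cl η.toFinset a ∧ c ∉ cl η.toFinset a ∧ c ∉ cl η.toFinset b ∧ ¬ Sep D (cl η.toFinset a) b c} η := by
  rw [← Finset.sum_add_distrib]
  refine Finset.sum_congr rfl fun η _ => ?_
  by_cases hη : η ⊆ ↑D
  · by_cases hb : b ∈ cl η.toFinset a
    · rw [ind_of_not_mem (fun h => h.1 hb), ind_of_not_mem (fun h => h.1 hb), ind_of_not_mem (fun h => h.1 hb)]
      ring
    by_cases hc : c ∈ cl η.toFinset a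
    · rw [ind_of_not_mem (fun h => h.2.1 hc), ind_of_not_mem (fun h => h.2.1 hc),
        ind_of_not_mem (fun h => h.2.1 hc)]
      ring
    by_cases hcb : c ∈ cl η.toFinset b
    · have hns : ¬ Sep D (cl η.toFinset a) b c :=
        not_sep_of_mem_cl (toFinset_subset_of_subset_coe hη) hb hcb
      rw [ind_of_not_mem (fun h => h.2.2 hcb), ind_of_not_mem (fun h => hns h.2.2),
        ind_of_not_mem (fun h => h.2.2.1 hcb)]
      ring
    by_cases hs : Sep D (cl η.toFinset a) b c
    · rw [ind_of_mem (show η ∈ {η : BondConfig V | b ∉ cl η.toFinset a ∧ c ∉ cl η.toFinset a ∧ c ∉ cl η.toFinset b} from ⟨hb, hc, hcb⟩), ind_of_mem (show η ∈ {η : BondConfig V | b ∉ cl η.toFinset a ∧ c ∉ cl η.toFinset a ∧ Sep D (cl η.toFinset a) b c} from ⟨hb, hc, hs⟩),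
        ind_of_not_mem (fun h => h.2.2.2 hs)]
      ring
    · rw [ind_of_mem (show η ∈ {η : BondConfig V | b ∉ cl η.toFinset a ∧ c ∉ cl η.toFinset a ∧ c ∉ cl η.toFinset b} from ⟨hb, hc, hcb⟩), ind_of_not_mem (fun h => hs h.2.2),
        ind_of_mem (show η ∈ {η : BondConfig V | b ∉ cl η.toFinset a ∧ c ∉ cl η.toFinset a ∧ c ∉ cl η.toFinset b ∧ ¬ Sep D (cl η.toFinset a) b c} from ⟨hb, hc, hcb, hs⟩)]
      ring
  · unfold rcWeightW; rw [weight_eq_zero_of_not_subset u hu hη]; ring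

omit hu hab hac hbc in
/-- The five partition cells exhaust the mass: `M = R(abc) + R(ab|c) + R(ac|b) + R(a|bc) + R(a|b|c)`. [this work] -/
theorem piece_total :
    ∑ η : BondConfig V, rcWeightW u q ({a, b, c} : Set V) η =
      (∑ η : BondConfig V, rcWeightW u q ({a, b, c} : Set V) η * ind {η : BondConfig V | b ∈ cl η.toFinset a ∧ c ∈ cl η.toFinset a} η) + (∑ η : BondConfig V, rcWeightW u q ({a, b, c} : Set V) η * ind {η : BondConfig V | b ∈ cl η.toFinset a ∧ c ∉ cl η.toFinset a} η) +
        (∑ η : BondConfig V, rcWeightW u q ({a, b, c} : Set V) η * ind {η : BondConfig V | b ∉ cl η.toFinset a ∧ c ∈ cl η.toFinset a} η) + (∑ η : BondConfig V, rcWeightW u q ({a, b, c} : Set V) η * ind {η : BondConfig V | b ∉ cl η.toFinset a ∧ c ∉ cl η.toFinset a ∧ c ∈ cl η.toFinset b} η) +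
        ∑ η : BondConfig V, rcWeightW u q ({a, b, c} : Set V) η * ind {η : BondConfig V | b ∉ cl η.toFinset a ∧ c ∉ cl η.toFinset a ∧ c ∉ cl η.toFinset b} η := by
  rw [← Finset.sum_add_distrib, ← Finset.sum_add_distrib, ← Finset.sum_add_distrib, ← Finset.sum_add_distrib]
  refine Finset.sum_congr rfl fun η _ => ?_
  by_cases hb : b ∈ cl η.toFinset a <;> by_cases hc : c ∈ cl η.toFinset a <;> by_cases hcb : c ∈ cl η.toFinset b
  all_goals
    first
    | (rw [ind_of_mem (show η ∈ {η : BondConfig V | b ∈ cl η.toFinset a ∧ c ∈ cl η.toFinset a} from ⟨hb, hc⟩), ind_of_not_mem (fun h : η ∈ {η : BondConfig V | b ∈ cl η.toFinset a ∧ c ∉ cl η.toFinset a} => h.2 hc),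
        ind_of_not_mem (fun h : η ∈ {η : BondConfig V | b ∉ cl η.toFinset a ∧ c ∈ cl η.toFinset a} => h.1 hb), ind_of_not_mem (fun h : η ∈ {η : BondConfig V | b ∉ cl η.toFinset a ∧ c ∉ cl η.toFinset a ∧ c ∈ cl η.toFinset b} => h.1 hb),
        ind_of_not_mem (fun h : η ∈ {η : BondConfig V | b ∉ cl η.toFinset a ∧ c ∉ cl η.toFinset a ∧ c ∉ cl η.toFinset b} => h.1 hb)]; ring)
    | (rw [ind_of_not_mem (fun h : η ∈ {η : BondConfig V | b ∈ cl η.toFinset a ∧ c ∈ cl η.toFinset a} => hc h.2), ind_of_mem (show η ∈ {η : BondConfig V | b ∈ cl η.toFinset a ∧ c ∉ cl η.toFinset a} from ⟨hb, hc⟩),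
        ind_of_not_mem (fun h : η ∈ {η : BondConfig V | b ∉ cl η.toFinset a ∧ c ∈ cl η.toFinset a} => h.1 hb), ind_of_not_mem (fun h : η ∈ {η : BondConfig V | b ∉ cl η.toFinset a ∧ c ∉ cl η.toFinset a ∧ c ∈ cl η.toFinset b} => h.1 hb),
        ind_of_not_mem (fun h : η ∈ {η : BondConfig V | b ∉ cl η.toFinset a ∧ c ∉ cl η.toFinset a ∧ c ∉ cl η.toFinset b} => h.1 hb)]; ring)
    | (rw [ind_of_not_mem (fun h : η ∈ {η : BondConfig V | b ∈ cl η.toFinset a ∧ c ∈ cl η.toFinset a} => hb h.1), ind_of_not_mem (fun h : η ∈ {η : BondConfig V | b ∈ cl η.toFinset a ∧ c ∉ cl η.toFinset a} => hb h.1),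
        ind_of_mem (show η ∈ {η : BondConfig V | b ∉ cl η.toFinset a ∧ c ∈ cl η.toFinset a} from ⟨hb, hc⟩), ind_of_not_mem (fun h : η ∈ {η : BondConfig V | b ∉ cl η.toFinset a ∧ c ∉ cl η.toFinset a ∧ c ∈ cl η.toFinset b} => h.2.1 hc),
        ind_of_not_mem (fun h : η ∈ {η : BondConfig V | b ∉ cl η.toFinset a ∧ c ∉ cl η.toFinset a ∧ c ∉ cl η.toFinset b} => h.2.1 hc)]; ring)
    | (rw [ind_of_not_mem (fun h : η ∈ {η : BondConfig V | b ∈ cl η.toFinset a ∧ c ∈ cl η.toFinset a} => hb h.1), ind_of_not_mem (fun h : η ∈ {η : BondConfig V | b ∈ cl η.toFinset a ∧ c ∉ cl η.toFinset a} => hb h.1),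
        ind_of_not_mem (fun h : η ∈ {η : BondConfig V | b ∉ cl η.toFinset a ∧ c ∈ cl η.toFinset a} => hc h.2), ind_of_mem (show η ∈ {η : BondConfig V | b ∉ cl η.toFinset a ∧ c ∉ cl η.toFinset a ∧ c ∈ cl η.toFinset b} from ⟨hb, hc, hcb⟩),
        ind_of_not_mem (fun h : η ∈ {η : BondConfig V | b ∉ cl η.toFinset a ∧ c ∉ cl η.toFinset a ∧ c ∉ cl η.toFinset b} => h.2.2 hcb)]; ring)
    | (rw [ind_of_not_mem (fun h : η ∈ {η : BondConfig V | b ∈ cl η.toFinset a ∧ c ∈ cl η.toFinset a} => hb h.1), ind_of_not_mem (fun h : η ∈ {η : BondConfig V | b ∈ cl η.toFinset a ∧ c ∉ cl η.toFinset a} => hb h.1),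
        ind_of_not_mem (fun h : η ∈ {η : BondConfig V | b ∉ cl η.toFinset a ∧ c ∈ cl η.toFinset a} => hc h.2), ind_of_not_mem (fun h : η ∈ {η : BondConfig V | b ∉ cl η.toFinset a ∧ c ∉ cl η.toFinset a ∧ c ∈ cl η.toFinset b} => hcb h.2.2),
        ind_of_mem (show η ∈ {η : BondConfig V | b ∉ cl η.toFinset a ∧ c ∉ cl η.toFinset a ∧ c ∉ cl η.toFinset b} from ⟨hb, hc, hcb⟩)]; ring)

end Piece

/-! ### The 3-sum theorem -/

section Main

variable {DA DB D : Finset (Sym2 V)} {a b c : V} (hab : a ≠ b) (hac : a ≠ c) (hbc : b ≠ c)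
  (hsepD : ∀ v : V, (∃ e ∈ DA, v ∈ e) → (∃ e ∈ DB, v ∈ e) → (v = a ∨ v = b ∨ v = c))
  (hD : ∀ e, e ∈ D ↔ e ∈ DA ∨ e ∈ DB)
  (w wA wB : Sym2 V → unitInterval) {q : ℝ} (hq : 0 < q)
  (hw : ∀ e, e ∉ (↑DA ∪ ↑DB : Set (Sym2 V)) → (w e : ℝ) = 0)
  (hA : ∀ e ∈ (↑DA : Set (Sym2 V)), wA e = w e) (hA' : ∀ e ∉ (↑DA : Set (Sym2 V)), wA e = 0)
  (hB : ∀ e ∈ (↑DA : Set (Sym2 V)), wB e = 0) (hB' : ∀ e ∉ (↑DA : Set (Sym2 V)), wB e = w e)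
include hab hac hbc hsepD hD hq hw hA hA' hB hB'

/-- **The 3-sum theorem for R1, measure level** (every `q > 0`): if the free random-cluster measures of the two
pieces of a graph glued along `{a,b,c}` satisfy R1, LB and LG for the instance `(a; b, c)`, then the free
random-cluster measure of the glued graph satisfies R1: `φ(T)·φ(S) ≤ φ(U_b)·φ(U_c)`. [this work] -/
theorem r1_of_threeSum
    (hR1A : (rcMeasureW wA q ∅).real {η : BondConfig V | b ∈ cl η.toFinset a ∧ c ∈ cl η.toFinset a} *
          (rcMeasureW wA q ∅).real {η : BondConfig V | b ∉ cl η.toFinset a ∧ c ∉ cl η.toFinset a ∧ Sep DA (cl η.toFinset a) b c} ≤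
        (rcMeasureW wA q ∅).real {η : BondConfig V | b ∈ cl η.toFinset a ∧ c ∉ cl η.toFinset a} *
          (rcMeasureW wA q ∅).real {η : BondConfig V | b ∉ cl η.toFinset a ∧ c ∈ cl η.toFinset a})
    (hLBA : (rcMeasureW wA q ∅).real {η : BondConfig V | b ∉ cl η.toFinset a ∧ c ∉ cl η.toFinset a ∧ Sep DA (cl η.toFinset a) b c} *
          (rcMeasureW wA q ∅).real {η : BondConfig V | b ∉ cl η.toFinset a ∧ c ∉ cl η.toFinset a ∧ c ∈ cl η.toFinset b} ≤
        (rcMeasureW wA q ∅).real {η : BondConfig V | b ∉ cl η.toFinset a ∧ c ∉ cl η.toFinset a ∧ c ∉ cl η.toFinset b ∧ ¬ Sep DA (cl η.toFinset a) b c} *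
          (rcMeasureW wA q ∅).real {η : BondConfig V | b ∈ cl η.toFinset a ∧ c ∉ cl η.toFinset a})
    (hLGA : (rcMeasureW wA q ∅).real {η : BondConfig V | b ∉ cl η.toFinset a ∧ c ∉ cl η.toFinset a ∧ Sep DA (cl η.toFinset a) b c} *
          (rcMeasureW wA q ∅).real {η : BondConfig V | b ∉ cl η.toFinset a ∧ c ∉ cl η.toFinset a ∧ c ∈ cl η.toFinset b} ≤
        (rcMeasureW wA q ∅).real {η : BondConfig V | b ∉ cl η.toFinset a ∧ c ∉ cl η.toFinset a ∧ c ∉ cl η.toFinset b ∧ ¬ Sep DA (cl η.toFinset a) b c} *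
          (rcMeasureW wA q ∅).real {η : BondConfig V | b ∉ cl η.toFinset a ∧ c ∈ cl η.toFinset a})
    (hR1B : (rcMeasureW wB q ∅).real {η : BondConfig V | b ∈ cl η.toFinset a ∧ c ∈ cl η.toFinset a} *
          (rcMeasureW wB q ∅).real {η : BondConfig V | b ∉ cl η.toFinset a ∧ c ∉ cl η.toFinset a ∧ Sep DB (cl η.toFinset a) b c} ≤
        (rcMeasureW wB q ∅).real {η : BondConfig V | b ∈ cl η.toFinset a ∧ c ∉ cl η.toFinset a} *
          (rcMeasureW wB q ∅).real {η : BondConfig V | b ∉ cl η.toFinset a ∧ c ∈ cl η.toFinset a})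
    (hLBB : (rcMeasureW wB q ∅).real {η : BondConfig V | b ∉ cl η.toFinset a ∧ c ∉ cl η.toFinset a ∧ Sep DB (cl η.toFinset a) b c} *
          (rcMeasureW wB q ∅).real {η : BondConfig V | b ∉ cl η.toFinset a ∧ c ∉ cl η.toFinset a ∧ c ∈ cl η.toFinset b} ≤
        (rcMeasureW wB q ∅).real {η : BondConfig V | b ∉ cl η.toFinset a ∧ c ∉ cl η.toFinset a ∧ c ∉ cl η.toFinset b ∧ ¬ Sep DB (cl η.toFinset a) b c} *
          (rcMeasureW wB q ∅).real {η : BondConfig V | b ∈ cl η.toFinset a ∧ c ∉ cl η.toFinset a})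
    (hLGB : (rcMeasureW wB q ∅).real {η : BondConfig V | b ∉ cl η.toFinset a ∧ c ∉ cl η.toFinset a ∧ Sep DB (cl η.toFinset a) b c} *
          (rcMeasureW wB q ∅).real {η : BondConfig V | b ∉ cl η.toFinset a ∧ c ∉ cl η.toFinset a ∧ c ∈ cl η.toFinset b} ≤
        (rcMeasureW wB q ∅).real {η : BondConfig V | b ∉ cl η.toFinset a ∧ c ∉ cl η.toFinset a ∧ c ∉ cl η.toFinset b ∧ ¬ Sep DB (cl η.toFinset a) b c} *
          (rcMeasureW wB q ∅).real {η : BondConfig V | b ∉ cl η.toFinset a ∧ c ∈ cl η.toFinset a}) :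
    (rcMeasureW w q ∅).real {η : BondConfig V | b ∈ cl η.toFinset a ∧ c ∈ cl η.toFinset a} *
          (rcMeasureW w q ∅).real {η : BondConfig V | b ∉ cl η.toFinset a ∧ c ∉ cl η.toFinset a ∧ Sep D (cl η.toFinset a) b c} ≤
        (rcMeasureW w q ∅).real {η : BondConfig V | b ∈ cl η.toFinset a ∧ c ∉ cl η.toFinset a} *
          (rcMeasureW w q ∅).real {η : BondConfig V | b ∉ cl η.toFinset a ∧ c ∈ cl η.toFinset a} := by
  -- supports of the pieces
  have hwA : ∀ e, e ∉ (↑DA : Set (Sym2 V)) → (wA e : ℝ) = 0 := fun e he => by rw [hA' e he]; rfl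
  have hwB : ∀ e, e ∉ (↑DB : Set (Sym2 V)) → (wB e : ℝ) = 0 := by
    intro e he
    by_cases heA : e ∈ (↑DA : Set (Sym2 V))
    · rw [hB e heA]; rfl
    · rw [hB' e heA]; exact hw e (fun h => h.elim heA he)
  have hDD : D = DA ∪ DB := by ext e; rw [Finset.mem_union]; exact hD e
  subst hDD
  -- positivity
  have hZ := rcPartitionFunctionW_pos w hq (∅ : Set V)
  have hZA := rcPartitionFunctionW_pos wA hq (∅ : Set V)
  have hZB := rcPartitionFunctionW_pos wB hq (∅ : Set V)
  have hK : 0 < q ^ clusterCount (∅ : BondConfig V) ({a, b, c} : Set V) := pow_pos hq _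
  have hnn : ∀ (u : Sym2 V → unitInterval) (E : Set (BondConfig V)),
      0 ≤ ∑ η : BondConfig V, rcWeightW u q ({a, b, c} : Set V) η * ind E η := fun u E =>
    Finset.sum_nonneg fun η _ => mul_nonneg (rcWeightW_nonneg u hq.le _ η) (ind_nonneg E η)
  -- the piece rows as inequalities of wired masses
  have rowA := And.intro hR1A (And.intro hLBA hLGA)
  have rowB := And.intro hR1B (And.intro hLBB hLGB)
  simp only [rcMeasureW_real_eq_sum_div w hq, rcMeasureW_real_eq_sum_div wA hq,
    rcMeasureW_real_eq_sum_div wB hq] at rowA rowB ⊢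
  rw [piece_T hab hac hbc, piece_Ub hab hac hbc, piece_Uc hab hac hbc, piece_N hab hac hbc,
    piece_S hab hac hbc wA q hwA, piece_E hab hac hbc] at rowA
  rw [piece_T hab hac hbc, piece_Ub hab hac hbc, piece_Uc hab hac hbc, piece_N hab hac hbc,
    piece_S hab hac hbc wB q hwB, piece_E hab hac hbc] at rowB
  -- clear denominators in the goal and use the dictionary
  rw [div_mul_div_comm, div_mul_div_comm]
  refine div_le_div_of_nonneg_right ?_ (mul_pos hZ hZ).le
  refine le_of_mul_le_mul_right (a := q ^ clusterCount (∅ : BondConfig V) ({a, b, c} : Set V) *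
    q ^ clusterCount (∅ : BondConfig V) ({a, b, c} : Set V)) ?_ (mul_pos hK hK)
  have eT := glued_T_sum hab hac hbc hsepD w wA wB q hw hA hA' hB hB'
  have eS := glued_S_sum hab hac hbc hsepD w wA wB q hw hA hA' hB hB'
  have eUb := glued_Ub_sum hab hac hbc hsepD w wA wB q hw hA hA' hB hB'
  have eUc := glued_Uc_sum hab hac hbc hsepD w wA wB q hw hA hA' hB hB'
  rw [show ∀ x y K : ℝ, x * y * (K * K) = (x * K) * (y * K) from fun x y K => by ring, eT, eS,
    show ∀ x y K : ℝ, x * y * (K * K) = (x * K) * (y * K) from fun x y K => by ring, eUb, eUc]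
  -- name the wired masses
  have splitA := piece_split wA q hwA (a := a) (b := b) (c := c)
  have splitB := piece_split wB q hwB (a := a) (b := b) (c := c)
  have totA := piece_total wA q (a := a) (b := b) (c := c)
  have totB := piece_total wB q (a := a) (b := b) (c := c)
  set tA := (∑ η : BondConfig V, rcWeightW wA q ({a, b, c} : Set V) η * ind {η : BondConfig V | b ∈ cl η.toFinset a ∧ c ∈ cl η.toFinset a} η) with htA
  set bA' := (∑ η : BondConfig V, rcWeightW wA q ({a, b, c} : Set V) η * ind {η : BondConfig V | b ∈ cl η.toFinset a ∧ c ∉ cl η.toFinset a} η) with hbA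
  set gA := (∑ η : BondConfig V, rcWeightW wA q ({a, b, c} : Set V) η * ind {η : BondConfig V | b ∉ cl η.toFinset a ∧ c ∈ cl η.toFinset a} η) with hgA
  set nA := (∑ η : BondConfig V, rcWeightW wA q ({a, b, c} : Set V) η * ind {η : BondConfig V | b ∉ cl η.toFinset a ∧ c ∉ cl η.toFinset a ∧ c ∈ cl η.toFinset b} η) with hnA
  set zA := (∑ η : BondConfig V, rcWeightW wA q ({a, b, c} : Set V) η * ind {η : BondConfig V | b ∉ cl η.toFinset a ∧ c ∉ cl η.toFinset a ∧ c ∉ cl η.toFinset b} η) with hzA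
  set sA := (∑ η : BondConfig V, rcWeightW wA q ({a, b, c} : Set V) η * ind {η : BondConfig V | b ∉ cl η.toFinset a ∧ c ∉ cl η.toFinset a ∧ Sep DA (cl η.toFinset a) b c} η) with hsA
  set eA := (∑ η : BondConfig V, rcWeightW wA q ({a, b, c} : Set V) η * ind {η : BondConfig V | b ∉ cl η.toFinset a ∧ c ∉ cl η.toFinset a ∧ c ∉ cl η.toFinset b ∧ ¬ Sep DA (cl η.toFinset a) b c} η) with heA
  set MA := (∑ η : BondConfig V, rcWeightW wA q ({a, b, c} : Set V) η) with hMA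
  set tB := (∑ η : BondConfig V, rcWeightW wB q ({a, b, c} : Set V) η * ind {η : BondConfig V | b ∈ cl η.toFinset a ∧ c ∈ cl η.toFinset a} η) with htB
  set bB' := (∑ η : BondConfig V, rcWeightW wB q ({a, b, c} : Set V) η * ind {η : BondConfig V | b ∈ cl η.toFinset a ∧ c ∉ cl η.toFinset a} η) with hbB
  set gB := (∑ η : BondConfig V, rcWeightW wB q ({a, b, c} : Set V) η * ind {η : BondConfig V | b ∉ cl η.toFinset a ∧ c ∈ cl η.toFinset a} η) with hgB
  set nB := (∑ η : BondConfig V, rcWeightW wB q ({a, b, c} : Set V) η * ind {η : BondConfig V | b ∉ cl η.toFinset a ∧ c ∉ cl η.toFinset a ∧ c ∈ cl η.toFinset b} η) with hnB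
  set zB := (∑ η : BondConfig V, rcWeightW wB q ({a, b, c} : Set V) η * ind {η : BondConfig V | b ∉ cl η.toFinset a ∧ c ∉ cl η.toFinset a ∧ c ∉ cl η.toFinset b} η) with hzB
  set sB := (∑ η : BondConfig V, rcWeightW wB q ({a, b, c} : Set V) η * ind {η : BondConfig V | b ∉ cl η.toFinset a ∧ c ∉ cl η.toFinset a ∧ Sep DB (cl η.toFinset a) b c} η) with hsB
  set eB := (∑ η : BondConfig V, rcWeightW wB q ({a, b, c} : Set V) η * ind {η : BondConfig V | b ∉ cl η.toFinset a ∧ c ∉ cl η.toFinset a ∧ c ∉ cl η.toFinset b ∧ ¬ Sep DB (cl η.toFinset a) b c} η) with heB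
  set MB := (∑ η : BondConfig V, rcWeightW wB q ({a, b, c} : Set V) η) with hMB
  -- the raw rows
  obtain ⟨r1A, lbA, lgA⟩ := rowA
  obtain ⟨r1B, lbB, lgB⟩ := rowB
  have hq2 : 0 < q ^ 2 := pow_pos hq 2
  have r1A' : sA * (tA + 0) ≤ bA' * gA := by
    rw [div_mul_div_comm, div_mul_div_comm, div_le_div_iff_of_pos_right (mul_pos hZA hZA)] at r1A
    refine le_of_mul_le_mul_left (a := q ^ 2) ?_ hq2
    calc q ^ 2 * (sA * (tA + 0)) = tA * (q ^ 2 * sA) := by ring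
      _ ≤ q * bA' * (q * gA) := r1A
      _ = q ^ 2 * (bA' * gA) := by ring
  have lbA' : sA * nA ≤ eA * bA' := by
    rw [div_mul_div_comm, div_mul_div_comm, div_le_div_iff_of_pos_right (mul_pos hZA hZA)] at lbA
    refine le_of_mul_le_mul_left (a := q ^ 3) ?_ (pow_pos hq 3)
    calc q ^ 3 * (sA * nA) = q ^ 2 * sA * (q * nA) := by ring
      _ ≤ q ^ 2 * eA * (q * bA') := lbA
      _ = q ^ 3 * (eA * bA') := by ring
  have lgA' : sA * nA ≤ eA * gA := by
    rw [div_mul_div_comm, div_mul_div_comm, div_le_div_iff_of_pos_right (mul_pos hZA hZA)] at lgA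
    refine le_of_mul_le_mul_left (a := q ^ 3) ?_ (pow_pos hq 3)
    calc q ^ 3 * (sA * nA) = q ^ 2 * sA * (q * nA) := by ring
      _ ≤ q ^ 2 * eA * (q * gA) := lgA
      _ = q ^ 3 * (eA * gA) := by ring
  have r1B' : sB * (tB + 0) ≤ bB' * gB := by
    rw [div_mul_div_comm, div_mul_div_comm, div_le_div_iff_of_pos_right (mul_pos hZB hZB)] at r1B
    refine le_of_mul_le_mul_left (a := q ^ 2) ?_ hq2
    calc q ^ 2 * (sB * (tB + 0)) = tB * (q ^ 2 * sB) := by ring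
      _ ≤ q * bB' * (q * gB) := r1B
      _ = q ^ 2 * (bB' * gB) := by ring
  have lbB' : sB * nB ≤ eB * bB' := by
    rw [div_mul_div_comm, div_mul_div_comm, div_le_div_iff_of_pos_right (mul_pos hZB hZB)] at lbB
    refine le_of_mul_le_mul_left (a := q ^ 3) ?_ (pow_pos hq 3)
    calc q ^ 3 * (sB * nB) = q ^ 2 * sB * (q * nB) := by ring
      _ ≤ q ^ 2 * eB * (q * bB') := lbB
      _ = q ^ 3 * (eB * bB') := by ring
  have lgB' : sB * nB ≤ eB * gB := by
    rw [div_mul_div_comm, div_mul_div_comm, div_le_div_iff_of_pos_right (mul_pos hZB hZB)] at lgB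
    refine le_of_mul_le_mul_left (a := q ^ 3) ?_ (pow_pos hq 3)
    calc q ^ 3 * (sB * nB) = q ^ 2 * sB * (q * nB) := by ring
      _ ≤ q ^ 2 * eB * (q * gB) := lgB
      _ = q ^ 3 * (eB * gB) := by ring
  -- the certificate at x = y = 0, d = 0
  have cert := WheelR1.wheel_certificate eA sA bA' gA 0 nA tA eB sB bB' gB 0 nB tB 0 0
    (hnn _ _) (hnn _ _) (hnn _ _) (hnn _ _) le_rfl (hnn _ _) (hnn _ _)
    (hnn _ _) (hnn _ _) (hnn _ _) (hnn _ _) le_rfl (hnn _ _) (hnn _ _)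
    le_rfl zero_le_one le_rfl zero_le_one
    r1A' lbA' lgA' r1B' lbB' lgB'
    (eA + sA) (eB + sB) (eA + sA + bA' + gA + 0) (eB + sB + bB' + gB + 0)
    (eA + sA + bA' + gA + 0 + nA + tA) (eB + sB + bB' + gB + 0 + nB + tB) _ _ _ _
    rfl rfl rfl rfl rfl rfl rfl rfl rfl rfl
  have hc2 := mul_le_mul_of_nonneg_left cert hq2.le
  rw [totA, totB, splitA, splitB]
  convert hc2 using 1 <;> ring

end Main

end ThreeSum

end Summit.CriticalPhenomena.PercolationContinuityZ3.Theorems
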